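import Literature.Analysis.FluidPDE.KatoLaiLowerEnergySymbols
import HarnessLib

/-!
# Kato–Lai in the periodic cylinder: the level-`3` energy along a level-`s` solution

Analysis/FluidPDE support file for the energy-method construction of Euler flows in the
periodic cylinder (`Literature.Analysis.FluidPDE.KatoLai1984_periodicCylinderUniformExistence`;
Kato–Lai 1984, §6 (proof of Thm II: "`T″ − T₂` may be chosen larger than a fixed positive
number" since `‖u(t)‖_{s₀} ≤ const`) and §5 (5.7)–(5.8)). For a solution in duality form `u` of
the level-`s` problem (`s ≥ 7`, `ε ≠ 0`) the pure level-`3` energy `e₃(t) = ‖D u(t)‖²`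
(`KatoLaiLowerEnergySymbols.d3Op`) is differentiable within `[0, T]` with
`e₃′(t) = −2 ⟪𝒜̂ u(t), D′ u(t)⟫` (`hasDerivWithinAt_lowerEnergy`; the increment `‖D(u(t) − u(t₀))‖²`
is `o(t − t₀)` because `D′` is a compact multiplier and `u` is weakly continuous and Lipschitz at
the `L²` level), `|e₃′| ≤ 256 K₃ e₃^{3/2}` by the tame level-`3` bound
(`abs_inner_klOpExt_d3pOp_le`), whence by comparison with `Y/(1 − K√Y t)²`
**`e₃(t) ≤ 4 (e₃(0) + 1)` for `t ≤ min T (1/(2K√(e₃(0)+1)))`**, `K = 256 K₃ + 1` depending only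
on `L` (`lowerEnergy_le`). This is the `s`-independent control of the `H³` size of the
level-`s` solution used for the restarts.

Everything is proved; no named fact and no `sorry` is introduced.

## References

* T. Kato, C. Y. Lai, J. Funct. Anal. 56 (1984) 15–28, §5, §6. [KatoLai1984]
-/

noncomputable section

open MeasureTheory Set Function Filter Topology TopologicalSpace Finset Asymptotics
open scoped NNReal ENNReal InnerProductSpace RealInnerProductSpace

namespace Literature.Analysis.FluidPDE

open FunctionSpaces FunctionSpaces.Torus UnitAddTorus

/-- Local notation for physical space `ℝ³ = EuclideanSpace ℝ (Fin 3)`. -/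
local notation "ℝ³" => EuclideanSpace ℝ (Fin 3)

namespace PeriodicCylinder

variable {L : ℝ} (hL : 0 < L) {s : ℕ} {ε : ℝ} (hs : 6 ≤ s) (hε : ε ≠ 0)

/-! ### The level-`3` pairing through `D′` and its tame bound -/

/-- **`⟪𝒜̂_N f, D′ (trunc N f)⟫ = P₃(truncField N f)`.** [cite: KatoLai1984, §5 (5.7)] -/
theorem inner_klOpApprox_d3pOp_trunc (N : ℕ) (f : SymL2 (Fin 3)) :
    ⟪klOpApprox hL s ε N f, d3pOp hs hε (SymL2.trunc N f)⟫_ℝ =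
      (∫ ξ, ⟪klOp L hL (isSmooth_truncField s ε N f) ξ, truncField s ε N f ξ⟫_ℝ) +
        ∑ i, ∫ ξ, ⟪(Torus.partialDeriv i)^[3] (klOp L hL (isSmooth_truncField s ε N f)) ξ,
          (Torus.partialDeriv i)^[3] (truncField s ε N f) ξ⟫_ℝ := by
  have hU := isSmooth_truncField s ε N f
  have hA := isSmooth_klOp hL hU
  have hf : SymL2.trunc N f = toSym s ε hU := (toSym_truncField s ε N f).symm
  have hvk : ∀ k, d3pOp hs hε (SymL2.trunc N f) k = ((pureSq 3 k : ℝ) : ℂ) • mFourierCoeff (EuclideanSpace.complexify ∘ truncField s ε N f) k := by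
    intro k
    rw [hf, d3pOp, SymL2.diag_apply, SymL2.ofSmooth_apply, smul_smul, d3pSymbol]
    congr 1
    have hw : ((klWeight s ε k : ℝ) : ℂ) ≠ 0 := by exact_mod_cast (klWeight_pos s ε k).ne'
    push_cast
    field_simp
  have h3 := hasSum_pureSq_mul_re_inner hA hU 3
  have hinner := SymL2.hasSum_inner (klOpApprox hL s ε N f) (d3pOp hs hε (SymL2.trunc N f))
  refine hinner.unique (h3.congr_fun fun k => ?_)
  rw [hvk k, inner_smul_right, klOpApprox, SymL2.ofSmooth_apply]
  simp only [Complex.ofReal_one, one_smul, RCLike.re_eq_complex_re, Complex.re_ofReal_mul]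

/-- **The tame level-`3` bound along truncations**: `|⟪𝒜̂_N f, D′(trunc N f)⟫| ≤ 128 K₃ ‖D (trunc N f)‖³`.
[cite: KatoLai1984, §5 (5.8)] -/
theorem exists_abs_inner_klOpApprox_d3pOp_le : ∃ K₃ : ℝ, 0 ≤ K₃ ∧ ∀ (s : ℕ) (ε : ℝ) (hs : 6 ≤ s) (hε : ε ≠ 0) (N : ℕ) (f : SymL2 (Fin 3)),
    |⟪klOpApprox hL s ε N f, d3pOp hs hε (SymL2.trunc N f)⟫_ℝ| ≤ 128 * K₃ * ‖d3Op s ε (SymL2.trunc N f)‖ ^ 3 := by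
  obtain ⟨K₃, hK₃0, hK₃⟩ := exists_abs_pairing_klOp_le hL (m := 3) le_rfl
  refine ⟨K₃, hK₃0, fun s ε hs hε N f => ?_⟩
  have hU := isSmooth_truncField s ε N f
  rw [inner_klOpApprox_d3pOp_trunc hL hs hε]
  set n := ‖d3Op s ε (SymL2.trunc N f)‖ with hn
  have hn0 : 0 ≤ n := norm_nonneg _
  have h3 : Torus.latNormSq 3 (truncField s ε N f) ≤ 16 * n ^ 2 := latNormSq_three_truncField_le_d3 N f
  have h0 : Torus.latNormSq 0 (truncField s ε N f) ≤ 16 * n ^ 2 := (Torus.latNormSq_mono hU (by norm_num)).trans h3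
  have hsq : Real.sqrt (Torus.latNormSq 3 (truncField s ε N f)) ≤ 4 * n := by
    rw [show 4 * n = Real.sqrt ((4 * n) ^ 2) from (Real.sqrt_sq (by positivity)).symm]
    exact Real.sqrt_le_sqrt (by nlinarith)
  have l0 := Torus.latNormSq_nonneg 0 (truncField s ε N f)
  calc _ ≤ K₃ * Real.sqrt (Torus.latNormSq 3 (truncField s ε N f)) *
        (Torus.latNormSq 0 (truncField s ε N f) + Torus.latNormSq 3 (truncField s ε N f)) := hK₃ _ hU
    _ ≤ K₃ * (4 * n) * (16 * n ^ 2 + 16 * n ^ 2) :=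
        mul_le_mul (mul_le_mul_of_nonneg_left hsq hK₃0) (add_le_add h0 h3) (add_nonneg l0 (Torus.latNormSq_nonneg 3 _)) (by positivity)
    _ = 128 * K₃ * n ^ 3 := by ring

/-- **The tame level-`3` bound in the limit**: `|⟪𝒜̂ f, D′ f⟫| ≤ 128 K₃ ‖D f‖³`, `K₃ = K₃(L)`.
[cite: KatoLai1984, §5 (5.8)] -/
theorem exists_abs_inner_klOpExt_d3pOp_le : ∃ K₃ : ℝ, 0 ≤ K₃ ∧ ∀ (s : ℕ) (ε : ℝ) (hs : 6 ≤ s) (hε : ε ≠ 0) (f : SymL2 (Fin 3)),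
    |⟪klOpExt hL s ε f, d3pOp hs hε f⟫_ℝ| ≤ 128 * K₃ * ‖d3Op s ε f‖ ^ 3 := by
  obtain ⟨K₃, hK₃0, hK₃⟩ := exists_abs_inner_klOpApprox_d3pOp_le hL
  refine ⟨K₃, hK₃0, fun s ε hs hε f => ?_⟩
  have h1 : Tendsto (fun N => |⟪klOpApprox hL s ε N f, d3pOp hs hε (SymL2.trunc N f)⟫_ℝ|) atTop
      (𝓝 |⟪klOpExt hL s ε f, d3pOp hs hε f⟫_ℝ|) :=
    (Filter.Tendsto.inner (𝕜 := ℝ) (tendsto_klOpApprox hL s ε f)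
      (((d3pOp hs hε).continuous.tendsto f).comp (SymL2.tendsto_trunc f))).abs
  have h2 : Tendsto (fun N => 128 * K₃ * ‖d3Op s ε (SymL2.trunc N f)‖ ^ 3) atTop (𝓝 (128 * K₃ * ‖d3Op s ε f‖ ^ 3)) :=
    ((((d3Op s ε).continuous.tendsto f).comp (SymL2.tendsto_trunc f)).norm.pow 3).const_mul _
  exact le_of_tendsto_of_tendsto' h1 h2 fun N => hK₃ s ε hs hε N f

/-! ### The level-`3` energy along a solution -/

section Sol

variable {φ : SymL2 (Fin 3)} {T : ℝ} {u : ℝ → SymL2 (Fin 3)}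

/-- Sequences converging within `[0, T]`: a tail lies in `[0, T]`. [folklore] -/
theorem exists_shift_mem_of_tendsto_nhdsWithin {x : ℕ → ℝ} {t₀ : ℝ} (hx : Tendsto x atTop (𝓝[Icc 0 T] t₀)) :
    ∃ N : ℕ, (∀ n, x (n + N) ∈ Icc 0 T) ∧ Tendsto (fun n => x (n + N)) atTop (𝓝 t₀) := by
  rw [tendsto_nhdsWithin_iff] at hx
  obtain ⟨N, hN⟩ := eventually_atTop.1 hx.2
  exact ⟨N, fun n => hN _ (Nat.le_add_left N n), hx.1.comp (tendsto_add_atTop_nat N)⟩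

/-- **The compact multiplier `D′` turns the weak continuity of `u` into norm continuity**:
`‖D′(u t − u t₀)‖ → 0` as `t → t₀` within `[0, T]` (`s ≥ 7`). [folklore] -/
theorem tendsto_norm_d3pOp_sub (hs7 : 7 ≤ s) (hu : KatoLai.IsFormSolution (embed s ε) (klForm hL s ε) φ T u)
    {t₀ : ℝ} (ht₀ : t₀ ∈ Icc 0 T) :
    Tendsto (fun t => ‖d3pOp hs hε (u t - u t₀)‖) (𝓝[Icc 0 T] t₀) (𝓝 0) := by
  rw [tendsto_iff_seq_tendsto]
  intro x hx
  obtain ⟨N, hmem, hxt⟩ := exists_shift_mem_of_tendsto_nhdsWithin hx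
  have hweak : SymL2.WeakTendsto (fun n => u (x (n + N))) (u t₀) := weakTendsto_sol hL s ε hu hmem ht₀ hxt
  have hD := hweak.tendsto_diag_of_vanishing (abs_d3pSymbol_le hs hε) (d3pSymbol_neg s ε) (vanishingSymbol_d3pSymbol hs7 hε)
  have h : Tendsto (fun n => ‖d3pOp hs hε (u (x (n + N)) - u t₀)‖) atTop (𝓝 0) := by
    have := tendsto_iff_norm_sub_tendsto_zero.1 hD
    refine this.congr fun n => ?_
    rw [map_sub]; rfl
  exact (tendsto_add_atTop_iff_nat N).1 h

/-- **The pure level-`3` energy is differentiable along the solution**: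
`dₜ ‖D u(t)‖² = −2 ⟪𝒜̂ u(t), D′ u(t)⟫` within `[0, T]` (`s ≥ 7`, `ε ≠ 0`). [cite: KatoLai1984, §5, §6] -/
theorem hasDerivWithinAt_lowerEnergy (hs7 : 7 ≤ s) (hu : KatoLai.IsFormSolution (embed s ε) (klForm hL s ε) φ T u) (hT : 0 ≤ T)
    {t₀ : ℝ} (ht₀ : t₀ ∈ Icc 0 T) :
    HasDerivWithinAt (fun t => ‖d3Op s ε (u t)‖ ^ 2) (-(2 * ⟪klOpExt hL s ε (u t₀), d3pOp hs hε (u t₀)⟫_ℝ)) (Icc 0 T) t₀ := by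
  set v₀ := d3pOp hs hε (u t₀) with hv₀
  -- `g t = ⟪i v₀, u t⟫` and its derivative from the equation
  have hg : HasDerivWithinAt (fun t => ⟪embed s ε v₀, u t⟫_ℝ) (-⟪klOpExt hL s ε (u t₀), v₀⟫_ℝ) (Icc 0 T) t₀ := by
    have h := hu.hasDerivWithinAt v₀ t₀ ht₀
    simpa [klForm_apply] using h
  -- the decomposition `e₃ t = e₃ t₀ + 2 (g t − g t₀) + ‖D (u t − u t₀)‖²`
  have hdec : ∀ t, ‖d3Op s ε (u t)‖ ^ 2 = ‖d3Op s ε (u t₀)‖ ^ 2 + 2 * (⟪embed s ε v₀, u t⟫_ℝ - ⟪embed s ε v₀, u t₀⟫_ℝ) +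
      ‖d3Op s ε (u t - u t₀)‖ ^ 2 := by
    intro t
    rw [norm_d3Op_sq hs hε (u t), norm_d3Op_sq hs hε (u t₀), norm_d3Op_sq hs hε (u t - u t₀), hv₀]
    simp only [map_sub, inner_sub_left, inner_sub_right]
    have hsymm : ⟪embed s ε (d3pOp hs hε (u t)), u t₀⟫_ℝ = ⟪embed s ε (d3pOp hs hε (u t₀)), u t⟫_ℝ := by
      rw [inner_embed_d3pOp, inner_embed_d3pOp, real_inner_comm]
    rw [hsymm]
    ring
  -- the remainder `r t = ‖D (u t − u t₀)‖²` is `o(t − t₀)`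
  obtain ⟨R, hR0, hR⟩ := exists_norm_klVel_sub_le hL s ε hu hT
  have hr_bound : ∀ t ∈ Icc 0 T, ‖d3Op s ε (u t - u t₀)‖ ^ 2 ≤ ‖d3pOp hs hε (u t - u t₀)‖ * (R * |t - t₀|) := by
    intro t ht
    rw [norm_d3Op_sq hs hε, inner_embed_left]
    calc ⟪d3pOp hs hε (u t - u t₀), embed s ε (u t - u t₀)⟫_ℝ
        ≤ ‖d3pOp hs hε (u t - u t₀)‖ * ‖embed s ε (u t - u t₀)‖ := real_inner_le_norm _ _
      _ ≤ ‖d3pOp hs hε (u t - u t₀)‖ * (R * |t - t₀|) := by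
          refine mul_le_mul_of_nonneg_left ?_ (norm_nonneg _)
          have := hR t ht t₀ ht₀
          rwa [klVel, klVel, ← map_sub] at this
  have hr : HasDerivWithinAt (fun t => ‖d3Op s ε (u t - u t₀)‖ ^ 2) 0 (Icc 0 T) t₀ := by
    rw [hasDerivWithinAt_iff_isLittleO]
    simp only [sub_self, map_zero, norm_zero, ne_eq, OfNat.ofNat_ne_zero, not_false_eq_true, zero_pow, sub_zero, smul_zero]
    rw [Asymptotics.isLittleO_iff]
    intro c hc
    have hη := tendsto_norm_d3pOp_sub hL hs hε hs7 hu ht₀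
    have hev : ∀ᶠ t in 𝓝[Icc 0 T] t₀, ‖d3pOp hs hε (u t - u t₀)‖ < c / (R + 1) :=
      hη (Iio_mem_nhds (by positivity))
    filter_upwards [hev, self_mem_nhdsWithin] with t ht htI
    rw [Real.norm_of_nonneg (sq_nonneg _), Real.norm_eq_abs]
    calc ‖d3Op s ε (u t - u t₀)‖ ^ 2 ≤ ‖d3pOp hs hε (u t - u t₀)‖ * (R * |t - t₀|) := hr_bound t htI
      _ ≤ c / (R + 1) * (R * |t - t₀|) := mul_le_mul_of_nonneg_right ht.le (by positivity)
      _ = c * |t - t₀| * (R / (R + 1)) := by ring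
      _ ≤ c * |t - t₀| * 1 := mul_le_mul_of_nonneg_left ((div_le_one (by positivity)).2 (by linarith)) (by positivity)
      _ = c * |t - t₀| := mul_one _
  -- assemble
  have hsum := ((hg.sub_const ⟪embed s ε v₀, u t₀⟫_ℝ).const_mul 2).const_add (‖d3Op s ε (u t₀)‖ ^ 2) |>.add hr
  simp only [mul_neg, add_zero] at hsum
  refine (hsum.congr (fun t _ => hdec t) (hdec t₀)).congr_deriv ?_
  ring

/-- **The `s`-independent bound of the `H³` size of a level-`s` solution**: with `K = 256 K₃ + 1`,
`Y = ‖D u(0)‖² + 1`, for `t ∈ [0, T]` with `t ≤ 1/(2K√Y)`: `‖D u(t)‖² ≤ 4 Y`.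
[cite: KatoLai1984, §6 (proof of Thm II)] -/
theorem exists_lowerEnergy_le : ∃ K : ℝ, 0 < K ∧ ∀ (s : ℕ) (ε : ℝ) (hs : 6 ≤ s) (_hε : ε ≠ 0), 7 ≤ s →
    ∀ {φ : SymL2 (Fin 3)} {T : ℝ} {u : ℝ → SymL2 (Fin 3)}, KatoLai.IsFormSolution (embed s ε) (klForm hL s ε) φ T u → 0 ≤ T →
      ∀ t ∈ Icc 0 T, t ≤ 1 / (2 * K * Real.sqrt (‖d3Op s ε (u 0)‖ ^ 2 + 1)) →
        ‖d3Op s ε (u t)‖ ^ 2 ≤ 4 * (‖d3Op s ε (u 0)‖ ^ 2 + 1) := by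
  obtain ⟨K₃, hK₃0, hK₃⟩ := exists_abs_inner_klOpExt_d3pOp_le hL
  refine ⟨256 * K₃ + 1, by positivity, fun s ε hs hε hs7 φ T u hu hT t ht htK => ?_⟩
  set K : ℝ := 256 * K₃ + 1 with hK
  have hKpos : 0 < K := by positivity
  set Y : ℝ := ‖d3Op s ε (u 0)‖ ^ 2 + 1 with hY
  have hYpos : 0 < Y := by positivity
  set c : ℝ := K * Real.sqrt Y with hc
  have hcpos : 0 < c := by positivity
  set T' : ℝ := min T (1 / (2 * c)) with hT'
  have htT' : t ∈ Icc 0 T' := ⟨ht.1, le_min ht.2 (by rw [hc, show 2 * (K * Real.sqrt Y) = 2 * K * Real.sqrt Y by ring]; exact htK)⟩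
  -- the energy and its derivative on `[0, T']`
  set f : ℝ → ℝ := fun τ => ‖d3Op s ε (u τ)‖ ^ 2 with hf
  set f' : ℝ → ℝ := fun τ => -(2 * ⟪klOpExt hL s ε (u τ), d3pOp hs hε (u τ)⟫_ℝ) with hf'
  have hT'T : T' ≤ T := min_le_left _ _
  have hfd : ∀ τ ∈ Icc 0 T', HasDerivWithinAt f (f' τ) (Icc 0 T') τ := fun τ hτ =>
    (hasDerivWithinAt_lowerEnergy hL hs hε hs7 hu hT ⟨hτ.1, hτ.2.trans hT'T⟩).mono (Icc_subset_Icc le_rfl hT'T)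
  have hfc : ContinuousOn f (Icc 0 T') := fun τ hτ => (hfd τ hτ).continuousWithinAt
  have hfd' : ∀ x ∈ Ico 0 T', HasDerivWithinAt f (f' x) (Ici x) x := fun x hx =>
    (hfd x ⟨hx.1, hx.2.le⟩).mono_of_mem_nhdsWithin (mem_of_superset (Icc_mem_nhdsGE hx.2) (Icc_subset_Icc hx.1 le_rfl))
  -- `f' ≤ K ‖D u‖³`
  have hf'le : ∀ τ, f' τ ≤ K * ‖d3Op s ε (u τ)‖ ^ 3 := fun τ => by
    have h := hK₃ s ε hs hε (u τ)
    have hn : 0 ≤ ‖d3Op s ε (u τ)‖ := norm_nonneg _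
    have h1 : f' τ ≤ |f' τ| := le_abs_self _
    have h2 : |f' τ| = 2 * |⟪klOpExt hL s ε (u τ), d3pOp hs hε (u τ)⟫_ℝ| := by
      rw [hf']; simp only; rw [abs_neg, abs_mul, abs_two]
    rw [h2] at h1
    have h3 : 2 * (128 * K₃ * ‖d3Op s ε (u τ)‖ ^ 3) ≤ K * ‖d3Op s ε (u τ)‖ ^ 3 := by
      rw [hK]; nlinarith [pow_nonneg hn 3]
    linarith
  -- the barrier `B τ = Y / (1 − c τ)²`
  set B : ℝ → ℝ := fun τ => Y / (1 - c * τ) ^ 2 with hB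
  set B' : ℝ → ℝ := fun τ => 2 * c * Y / (1 - c * τ) ^ 3 with hB'
  have hden : ∀ τ ∈ Icc 0 T', 1 / 2 ≤ 1 - c * τ := fun τ hτ => by
    have h1 : τ ≤ 1 / (2 * c) := hτ.2.trans (min_le_right _ _)
    have h2 : c * τ ≤ c * (1 / (2 * c)) := mul_le_mul_of_nonneg_left h1 hcpos.le
    rw [show c * (1 / (2 * c)) = 1 / 2 by field_simp] at h2
    linarith
  have hBd : ∀ τ ∈ Icc 0 T', HasDerivAt B (B' τ) τ := fun τ hτ => by
    have hpos : 0 < 1 - c * τ := lt_of_lt_of_le (by norm_num) (hden τ hτ)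
    have hlin : HasDerivAt (fun σ => 1 - c * σ) (-c) τ := by
      simpa using ((hasDerivAt_id τ).const_mul c).const_sub 1
    have h1 : HasDerivAt (fun σ => (1 - c * σ) ^ 2) (2 * (1 - c * τ) * (-c)) τ := by
      refine (hlin.pow 2).congr_deriv ?_
      norm_num
    have h2 := (h1.inv (pow_ne_zero 2 hpos.ne')).const_mul Y
    have e : Y * (-(2 * (1 - c * τ) * -c) / ((1 - c * τ) ^ 2) ^ 2) = B' τ := by
      rw [hB']; simp only; field_simp
    rw [← e]
    refine h2.congr_of_eventuallyEq (Eventually.of_forall fun σ => ?_)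
    rw [hB]; simp only [Pi.inv_apply, div_eq_mul_inv]
  have hBc : ContinuousOn B (Icc 0 T') := fun τ hτ => (hBd τ hτ).continuousAt.continuousWithinAt
  have hBd' : ∀ x ∈ Ico 0 T', HasDerivWithinAt B (B' x) (Ici x) x := fun x hx => (hBd x ⟨hx.1, hx.2.le⟩).hasDerivWithinAt
  have hf0 : f 0 ≤ B 0 := by
    rw [hf, hB]; simp only; rw [mul_zero, sub_zero, one_pow, div_one, hY]; linarith
  have hbound : ∀ x ∈ Ico 0 T', f x = B x → f' x < B' x := by
    intro x hx hfx
    have hxI : x ∈ Icc 0 T' := ⟨hx.1, hx.2.le⟩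
    have hpos : 0 < 1 - c * x := lt_of_lt_of_le (by norm_num) (hden x hxI)
    have hBx : B x = Y / (1 - c * x) ^ 2 := rfl
    have hsB : Real.sqrt (B x) = Real.sqrt Y / (1 - c * x) := by
      rw [hBx, Real.sqrt_div hYpos.le, Real.sqrt_sq hpos.le]
    have hn3 : ‖d3Op s ε (u x)‖ ^ 3 = B x * Real.sqrt (B x) := by
      have hn : ‖d3Op s ε (u x)‖ = Real.sqrt (B x) := by
        rw [← hfx, hf]; exact (Real.sqrt_sq (norm_nonneg _)).symm
      rw [hn, pow_succ, Real.sq_sqrt (by rw [hBx]; positivity)]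
    calc f' x ≤ K * ‖d3Op s ε (u x)‖ ^ 3 := hf'le x
      _ = K * (B x * Real.sqrt (B x)) := by rw [hn3]
      _ = c * Y / (1 - c * x) ^ 3 := by rw [hsB, hBx, hc]; field_simp
      _ < 2 * c * Y / (1 - c * x) ^ 3 := by
          rw [div_lt_div_iff_of_pos_right (pow_pos hpos 3)]
          nlinarith
      _ = B' x := rfl
  have hle := image_le_of_deriv_right_lt_deriv_boundary' hfc hfd' hf0 hBc hBd' hbound htT'
  -- `B t ≤ 4 Y`
  have hBt : B t ≤ 4 * Y := by
    have hd := hden t htT'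
    have hpos : 0 < 1 - c * t := lt_of_lt_of_le (by norm_num) hd
    show Y / (1 - c * t) ^ 2 ≤ 4 * Y
    rw [div_le_iff₀ (pow_pos hpos 2)]
    have hq : (1 / 2 : ℝ) ^ 2 ≤ (1 - c * t) ^ 2 := pow_le_pow_left₀ (by norm_num) hd 2
    nlinarith
  exact hle.trans hBt

end Sol

end PeriodicCylinder

end Literature.Analysis.FluidPDE
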